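/-
Origin: expansion seat `prover-pub-hodgecm-mc-carch-1-0`, handover #CA8 2026-08-20T00:05Z md5 a94f8b9ebe8b (450 l.; NEW additive leaf; imports Model.ArchKTypeOfSection (#CA6), Model.ArchKTypeOfBlockSection (#CA7), Model.HypCensus.ArchDatumBlockFramesCM (RUN 36); RUN 38; INSTALL after #CA6,#CA7; cert certs/ax-ArchKTypeOfFrameMatch-a94f8b9ebe8b.log: RUN-37 mirror world rc 0 / 0 warnings / 40/40 trio) (`HOME/mc/pub-hodgecm-mc-carch-1/pkg38/HodgeCM/Model/ArchKTypeOfFrameMatch.lean`, md5 a94f8b9ebe8b, 450 lines);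
landed by the second packager (p2) in gate run 38 as `HodgeCM/Model/ArchKTypeOfFrameMatch.lean` (verbatim).
-/
/-
Copyright (c) 2026. Released under Apache 2.0 license as described in the file LICENSE.
Cell pub-hodgecm, MODEL layer (construction prover mc-carch-1, gen 0), BINDER-OWNERS row 12 `C`, junction (J-x₀)⇄(J-arch): the FRAME
MATCHING `hωA` of `Model/ArchKTypeOfFrame` — #1097's `ι₁`-section in the rational CM frame (`Model/ArchKTypeOfSection`) IS binder-2's block
section (`Model/ArchKTypeOfBlockSection`) on the twisted ball frame, for the CANONICAL (Sylvester-permutation) frame bijections `eP`, `eQ`.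
-/
import Summits.HodgeConjecture.HodgeCM.Model.ArchKTypeOfSection
import Summits.HodgeConjecture.HodgeCM.Model.ArchKTypeOfBlockSection
import Summits.HodgeConjecture.HodgeCM.Model.HypCensus.ArchDatumBlockFramesCM

/-!
# Frame matching: the `ι₁`-section of record against binder-2's block section

Objects (`V : HermSpace3 L ι₁`, `d = frameD V`, `g = frameG V`, `σ = V.rationalFramePerm`, `r i = re ι₁(d i)`, `s j = 1/√|r (σ j)|`,
`T = V.sylvesterFrame = ι₁(g)∘σ · diag s`):
* § 1 the sign fact at `ι₁` in discharge-3's shape (`frameD_h21`: `r (σ 2) < 0`, the other two positive), the pin sign vector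
  `x_V(v₁) i = r i` (`cmXV_cmPlace_frameD`), and the **canonical frame bijections** `blockPosEquiv V : PosIdx x_V(v₁) ≃ Fin 2`
  (`⟨σ 0, _⟩ ↦ 0`, `⟨σ 1, _⟩ ↦ 1`) and `blockNegEquiv V : NegIdx x_V(v₁) ≃ Unit` — the `eP`, `eQ` under which no permutation of the
  two positive ball coordinates intervenes;
* § 2 the index identity `signSplit x_V(v₁) ∘ σ = (eP ⊕ eQ)⁻¹ ∘ frameIdx` (`cmEpsV_perm`);
* § 3 the twist `twistU21 : U21 →* U21` (entrywise `embTwist L ι₁`; `J` is real), an involution;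
* § 4 the matrix identity `GL₃(embTwist)(F⁻¹ (T u T⁻¹) F) = (D_s · tw u · D_s⁻¹)^{σ⁻¹,σ⁻¹}` (`coe_map_embTwist_frameConj`), binder-2's
  scaling against the Sylvester scaling `√|x_V(v₁) i| · s (σ⁻¹ i) = 1` (`cmDV_mul_sylvesterScale`), and the inverse pair frame on the
  twisted ball frame **`coe_cmPairFrameEquiv_symm_twist_fst`** (by injectivity of weil-2's `toUForm`: both sides frame to the same
  `reindex (eP ⊕ eQ)⁻¹ (reindex frameIdx (tw u))`);
* § 5 in `U(diag d)(L ⊗ ℝ)`, place by place (`archPiEquiv` injective, `cmPlaceOver (cmPlace ι₁) = cmPlace ι₁`):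
  **`cmBlockSection_twist : cmBlockSection eP eQ (u21FrameEquiv (twistU21 u), 1) = (archSectionFrameOf V u, 1)`** and
  **`cmBlockSection_u21FrameEquiv : cmBlockSection eP eQ (u21FrameEquiv u, 1) = (archSectionFrameOf V (twistU21 u), 1)`** —
  the frame matching `hωA` of `Model/ArchKTypeOfFrame` § 3 up to the line scalar (trivial along `exp 𝔭`, `Model/ArchKTypeOfLines`).
Nothing is cited and nothing is minted: kernel lemmas on installed definitions.
-/

set_option autoImplicit false

noncomputable section

open NumberField NumberField.InfinitePlace NumberField.mixedEmbedding IsDedekindDomain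
open scoped Matrix Classical
open Literature.Geometry.ComplexHyperbolic.BallModel (U21 mat)
open Literature.NumberTheory.Automorphic
open Literature.NumberTheory.Weil1964
open Literature.RepresentationTheory.KonnoKonno2007 Literature.RepresentationTheory.KonnoKonno2007.RealDualPair
open Literature.NumberTheory.GelbartRogawski1991 Literature.NumberTheory.GelbartRogawski1991.UnitaryDualPair

namespace HodgeCM.Model

variable {L : CMField} {ι₁ : L →+* ℂ} (V : HermSpace3 L ι₁)

/-! ## § 1 Signs at the pin and the canonical frame bijections -/

/-- `re ι₁ (frameD V i) = r i`. -/
theorem re_ι₁_frameD (i : Fin 3) : (ι₁ (frameD V i)).re = V.rationalFrame_r i := rfl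

/-- every index is `σ j` for `j = σ⁻¹ i`, and `j ≠ 2` means `j = 0 ∨ j = 1`. -/
theorem rationalFrame_r_pos_of_ne {i : Fin 3} (hi : i ≠ V.rationalFramePerm 2) : 0 < V.rationalFrame_r i := by
  obtain ⟨j, rfl⟩ := V.rationalFramePerm.surjective i
  have hj : j ≠ 2 := fun h => hi (by rw [h])
  fin_cases j
  · exact V.rationalFrame_r_perm_zero_pos
  · exact V.rationalFrame_r_perm_one_pos
  · exact absurd rfl hj

/-- **the sign fact at `ι₁` in discharge-3's shape**: `re ι₁(d (σ 2)) < 0` and `re ι₁(d i) > 0` for `i ≠ σ 2`. -/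
theorem frameD_h21 : ∃ i₀ : Fin 3, (ι₁ (frameD V i₀)).re < 0 ∧ ∀ i, i ≠ i₀ → 0 < (ι₁ (frameD V i)).re :=
  ⟨V.rationalFramePerm 2, V.rationalFrame_r_perm_two_neg, fun _ hi => (rationalFrame_r_pos_of_ne V) hi⟩

/-- its weak form (the hypothesis of `cmXV_cmPlace_apply`). -/
theorem frameD_h21' : ∃ i₀ : Fin 3, ∀ i, i ≠ i₀ → 0 < (ι₁ (frameD V i)).re :=
  ⟨V.rationalFramePerm 2, fun _ hi => (rationalFrame_r_pos_of_ne V) hi⟩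

/-- **the pin sign vector is `r`**: `x_V(v₁) i = re ι₁(d i)`. -/
theorem cmXV_cmPlace_frameD (i : Fin 3) :
    HypCensus.cmXV (L : Type) (frameD V) (frameD_real V) ι₁ (HypCensus.cmPlace (L : Type) ι₁) i = V.rationalFrame_r i :=
  HypCensus.cmXV_cmPlace_apply (L : Type) (frameD V) (frameD_real V) ι₁ (frameD_h21' V) i

/-- `x_V(v₁) (σ 0) > 0`, `x_V(v₁) (σ 1) > 0` (as `Fin.castSucc j`, `j : Fin 2`). -/
theorem cmXV_cmPlace_perm_castSucc_pos (j : Fin 2) :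
    0 < HypCensus.cmXV (L : Type) (frameD V) (frameD_real V) ι₁ (HypCensus.cmPlace (L : Type) ι₁)
      (V.rationalFramePerm (Fin.castSucc j)) := by
  rw [cmXV_cmPlace_frameD]
  fin_cases j
  · exact V.rationalFrame_r_perm_zero_pos
  · exact V.rationalFrame_r_perm_one_pos

/-- `x_V(v₁) (σ 2) ≤ 0`. -/
theorem not_cmXV_cmPlace_perm_two_pos :
    ¬0 < HypCensus.cmXV (L : Type) (frameD V) (frameD_real V) ι₁ (HypCensus.cmPlace (L : Type) ι₁) (V.rationalFramePerm 2) := by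
  rw [cmXV_cmPlace_frameD]
  exact not_lt.2 V.rationalFrame_r_perm_two_neg.le

/-- a non-positive index is `σ 2`. -/
theorem eq_perm_two_of_not_pos {i : Fin 3}
    (h : ¬0 < HypCensus.cmXV (L : Type) (frameD V) (frameD_real V) ι₁ (HypCensus.cmPlace (L : Type) ι₁) i) :
    i = V.rationalFramePerm 2 := by
  by_contra hne
  rw [cmXV_cmPlace_frameD] at h
  exact h ((rationalFrame_r_pos_of_ne V) hne)

/-- a positive index is not `σ 2`: `σ⁻¹ i ≠ Fin.last 2`. -/
theorem perm_symm_ne_last_of_pos {i : Fin 3}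
    (h : 0 < HypCensus.cmXV (L : Type) (frameD V) (frameD_real V) ι₁ (HypCensus.cmPlace (L : Type) ι₁) i) :
    V.rationalFramePerm.symm i ≠ Fin.last 2 := by
  intro h2
  have : i = V.rationalFramePerm 2 := by rw [← Equiv.apply_symm_apply V.rationalFramePerm i, h2]; rfl
  exact (not_cmXV_cmPlace_perm_two_pos V) (this ▸ h)

/-- **`eP` (canonical)**: the positive block `{σ 0, σ 1}` of the pin frame, numbered through `σ`. -/
def blockPosEquiv :
    PosIdx (HypCensus.cmXV (L : Type) (frameD V) (frameD_real V) ι₁ (HypCensus.cmPlace (L : Type) ι₁)) ≃ Fin 2 where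
  toFun p := (V.rationalFramePerm.symm p.1).castPred ((perm_symm_ne_last_of_pos V) p.2)
  invFun j := ⟨V.rationalFramePerm (Fin.castSucc j), (cmXV_cmPlace_perm_castSucc_pos V) j⟩
  left_inv p := Subtype.ext (by simp)
  right_inv j := by simp

/-- `eP⁻¹ j = σ j`. -/
@[simp] theorem coe_blockPosEquiv_symm_apply (j : Fin 2) : (((blockPosEquiv V).symm j : PosIdx _) : Fin 3) =
    V.rationalFramePerm (Fin.castSucc j) := rfl

/-- **`eQ` (canonical)**: the negative block `{σ 2}` of the pin frame is a point. -/
def blockNegEquiv :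
    NegIdx (HypCensus.cmXV (L : Type) (frameD V) (frameD_real V) ι₁ (HypCensus.cmPlace (L : Type) ι₁)) ≃ Unit where
  toFun _ := ()
  invFun _ := ⟨V.rationalFramePerm 2, (not_cmXV_cmPlace_perm_two_pos V)⟩
  left_inv p := Subtype.ext ((eq_perm_two_of_not_pos V) p.2).symm
  right_inv _ := rfl

/-- `eQ⁻¹ () = σ 2`. -/
@[simp] theorem coe_blockNegEquiv_symm_apply (x : Unit) : (((blockNegEquiv V).symm x : NegIdx _) : Fin 3) =
    V.rationalFramePerm 2 := rfl

/-- the positive index type of the pin frame. -/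
abbrev PinPos : Type :=
  PosIdx (HypCensus.cmXV (L : Type) (frameD V) (frameD_real V) ι₁ (HypCensus.cmPlace (L : Type) ι₁))

/-- the non-positive index type of the pin frame. -/
abbrev PinNeg : Type :=
  NegIdx (HypCensus.cmXV (L : Type) (frameD V) (frameD_real V) ι₁ (HypCensus.cmPlace (L : Type) ι₁))

/-! ## § 2 The index identity -/

/-- **`signSplit x_V(v₁) (σ j) = (eP ⊕ eQ)⁻¹ (frameIdx j)`** for `j = 0, 1, 2`. -/
theorem cmEpsV_perm (j : Fin 3) :
    HypCensus.cmEpsV (L : Type) (frameD V) (frameD_real V) ι₁ (HypCensus.cmPlace (L : Type) ι₁) (V.rationalFramePerm j) =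
      (Equiv.sumCongr (blockPosEquiv V) (blockNegEquiv V)).symm (frameIdx j) := by
  fin_cases j
  · have h := (cmXV_cmPlace_perm_castSucc_pos V) 0
    simp only [HypCensus.cmEpsV, signSplit, Equiv.sumCongr_symm, Fin.zero_eta, frameIdx_zero, Equiv.sumCongr_apply, Sum.map_inl]
    rw [Equiv.sumCompl_symm_apply_of_pos]
    · exact congrArg Sum.inl (Subtype.ext rfl)
    · exact h
  · have h := (cmXV_cmPlace_perm_castSucc_pos V) 1
    simp only [HypCensus.cmEpsV, signSplit, Equiv.sumCongr_symm, Fin.mk_one, frameIdx_one, Equiv.sumCongr_apply, Sum.map_inl]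
    rw [Equiv.sumCompl_symm_apply_of_pos]
    · exact congrArg Sum.inl (Subtype.ext rfl)
    · exact h
  · simp only [HypCensus.cmEpsV, signSplit, Equiv.sumCongr_symm, Fin.reduceFinMk, frameIdx_two, Equiv.sumCongr_apply, Sum.map_inr]
    rw [Equiv.sumCompl_symm_apply_of_neg]
    · exact congrArg Sum.inr (Subtype.ext rfl)
    · exact (not_cmXV_cmPlace_perm_two_pos V)

/-- … equivalently `frameIdx⁻¹ ((eP ⊕ eQ) (signSplit x_V(v₁) i)) = σ⁻¹ i`. -/
theorem frameIdx_symm_sumCongr_cmEpsV (i : Fin 3) :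
    frameIdx.symm (Equiv.sumCongr (blockPosEquiv V) (blockNegEquiv V)
      (HypCensus.cmEpsV (L : Type) (frameD V) (frameD_real V) ι₁ (HypCensus.cmPlace (L : Type) ι₁) i)) =
      V.rationalFramePerm.symm i := by
  obtain ⟨j, rfl⟩ := V.rationalFramePerm.surjective i
  rw [cmEpsV_perm, Equiv.apply_symm_apply, Equiv.symm_apply_apply, Equiv.symm_apply_apply]

/-! ## § 3 The twist of the ball frame -/

section Twist

variable (E : Type) [Field E] (τ : E →+* ℂ)

/-- `embTwist τ` fixes the reals. -/
theorem embTwist_ofReal (r : ℝ) : UnitaryGroup.embTwist E τ (r : ℂ) = r := by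
  by_cases h : (InfinitePlace.mk τ).embedding = τ
  · rw [UnitaryGroup.embTwist_apply_of_eq E τ h]
  · rw [UnitaryGroup.embTwist_apply_of_ne E τ h, Complex.conj_ofReal]

/-- `ᴴ` commutes with the entrywise twist. -/
theorem conjTranspose_map_embTwist {m n : Type} (A : Matrix m n ℂ) :
    (A.map (UnitaryGroup.embTwist E τ))ᴴ = Aᴴ.map (UnitaryGroup.embTwist E τ) := by
  ext i j
  simp only [Matrix.conjTranspose_apply, Matrix.map_apply]
  exact (UnitaryGroup.embTwist_conj E τ _).symm

/-- `J = diag(1, 1, −1)` is fixed by the entrywise twist. -/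
theorem J_map_embTwist :
    Literature.Geometry.ComplexHyperbolic.BallModel.J.map (UnitaryGroup.embTwist E τ) =
      Literature.Geometry.ComplexHyperbolic.BallModel.J := by
  rw [Literature.Geometry.ComplexHyperbolic.BallModel.J, Matrix.diagonal_map (map_zero _)]
  congr 1
  funext i
  fin_cases i <;> simp

end Twist

/-- **the twist of `U(2,1)`**: `u ↦ embTwist L ι₁ ∘ u` entrywise (a group endomorphism — `J` is real and the twist commutes
with `ᴴ`; the identity if Mathlib's `(mk ι₁).embedding = ι₁`, entrywise complex conjugation otherwise). -/
def twistU21 (L : CMField) (ι₁ : L →+* ℂ) : U21 →* U21 where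
  toFun u :=
    ⟨Matrix.GeneralLinearGroup.map (UnitaryGroup.embTwist (L : Type) ι₁) (u : GL (Fin 3) ℂ), by
      have hu : ((u : GL (Fin 3) ℂ) : Matrix (Fin 3) (Fin 3) ℂ)ᴴ * Literature.Geometry.ComplexHyperbolic.BallModel.J *
          ((u : GL (Fin 3) ℂ) : Matrix (Fin 3) (Fin 3) ℂ) = Literature.Geometry.ComplexHyperbolic.BallModel.J := u.2
      show (((u : GL (Fin 3) ℂ) : Matrix (Fin 3) (Fin 3) ℂ).map (UnitaryGroup.embTwist (L : Type) ι₁))ᴴ *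
          Literature.Geometry.ComplexHyperbolic.BallModel.J *
          ((u : GL (Fin 3) ℂ) : Matrix (Fin 3) (Fin 3) ℂ).map (UnitaryGroup.embTwist (L : Type) ι₁) =
        Literature.Geometry.ComplexHyperbolic.BallModel.J
      rw [conjTranspose_map_embTwist, ← J_map_embTwist (L : Type) ι₁, ← Matrix.map_mul, ← Matrix.map_mul, hu]⟩
  map_one' := Subtype.ext (map_one _)
  map_mul' u u' := Subtype.ext (map_mul _ _ _)

/-- `twistU21 u = GL₃(embTwist L ι₁) u` in `GL₃(ℂ)`. -/
@[simp] theorem coe_twistU21 (u : U21) :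
    ((twistU21 L ι₁ u : U21) : GL (Fin 3) ℂ) = Matrix.GeneralLinearGroup.map (UnitaryGroup.embTwist (L : Type) ι₁) (u : GL (Fin 3) ℂ) :=
  rfl

/-- its matrix: `mat (twistU21 u) = (mat u).map (embTwist L ι₁)`. -/
@[simp] theorem mat_twistU21 (u : U21) : mat (twistU21 L ι₁ u) = (mat u).map (UnitaryGroup.embTwist (L : Type) ι₁) := rfl

/-! ## § 4 The matrix identity -/

/-- `s j ≠ 0` in `ℂ`. -/
theorem sylvesterScale_coe_ne_zero (j : Fin 3) : ((V.sylvesterScale j : ℝ) : ℂ) ≠ 0 :=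
  Complex.ofReal_ne_zero.2 (V.sylvesterScale_pos j).ne'

/-- `T = F · (P_σ · D_s)`, `F = ι₁(g)`, `P_σ = 1∘σ`, `D_s = diag s`. -/
theorem coe_sylvesterFrame_eq_mul :
    ((V.sylvesterFrame : GL (Fin 3) ℂ) : Matrix (Fin 3) (Fin 3) ℂ) =
      ((Matrix.GeneralLinearGroup.map ι₁ (frameG V) : GL (Fin 3) ℂ) : Matrix (Fin 3) (Fin 3) ℂ) *
        ((1 : Matrix (Fin 3) (Fin 3) ℂ).submatrix id V.rationalFramePerm *
          Matrix.diagonal fun j => ((V.sylvesterScale j : ℝ) : ℂ)) := by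
  rw [HermSpace3.sylvesterFrame_eq_rationalFrame_adapted, HermSpace3.submatrix_id_eq_mul, Matrix.mul_assoc]
  rfl

/-- `F⁻¹ T = P_σ · D_s`. -/
theorem coe_frameInv_mul_sylvesterFrame :
    ((((Matrix.GeneralLinearGroup.map ι₁ (frameG V))⁻¹ * V.sylvesterFrame : GL (Fin 3) ℂ)) : Matrix (Fin 3) (Fin 3) ℂ) =
      (1 : Matrix (Fin 3) (Fin 3) ℂ).submatrix id V.rationalFramePerm * Matrix.diagonal fun j => ((V.sylvesterScale j : ℝ) : ℂ) := by
  rw [Units.val_mul, coe_sylvesterFrame_eq_mul, Units.inv_mul_cancel_left]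

/-- `(F⁻¹ T)⁻¹ = D_s⁻¹ · P_σ⁻¹`. -/
theorem coe_frameInv_mul_sylvesterFrame_inv :
    ((((Matrix.GeneralLinearGroup.map ι₁ (frameG V))⁻¹ * V.sylvesterFrame)⁻¹ : GL (Fin 3) ℂ) : Matrix (Fin 3) (Fin 3) ℂ) =
      (Matrix.diagonal fun j => (((V.sylvesterScale j : ℝ) : ℂ))⁻¹) *
        (1 : Matrix (Fin 3) (Fin 3) ℂ).submatrix V.rationalFramePerm id := by
  rw [Matrix.coe_units_inv, coe_frameInv_mul_sylvesterFrame]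
  apply Matrix.inv_eq_right_inv
  have hD : (Matrix.diagonal fun j => ((V.sylvesterScale j : ℝ) : ℂ)) *
      Matrix.diagonal (fun j => (((V.sylvesterScale j : ℝ) : ℂ))⁻¹) = 1 := by
    rw [Matrix.diagonal_mul_diagonal, ← Matrix.diagonal_one]
    congr 1
    funext j
    exact mul_inv_cancel₀ (sylvesterScale_coe_ne_zero V j)
  rw [Matrix.mul_assoc, ← Matrix.mul_assoc (Matrix.diagonal _), hD, Matrix.one_mul, Matrix.one_submatrix_mul,
    Matrix.submatrix_submatrix, Function.comp_id, Equiv.self_comp_symm, Function.comp_id, Matrix.submatrix_id_id]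

/-- `GL₃(embTwist)` fixes `P_σ · D_s` … -/
theorem map_embTwist_perm_mul_diagonal :
    ((1 : Matrix (Fin 3) (Fin 3) ℂ).submatrix id V.rationalFramePerm * Matrix.diagonal fun j => ((V.sylvesterScale j : ℝ) : ℂ)).map
        (UnitaryGroup.embTwist (L : Type) ι₁) =
      (1 : Matrix (Fin 3) (Fin 3) ℂ).submatrix id V.rationalFramePerm * Matrix.diagonal fun j => ((V.sylvesterScale j : ℝ) : ℂ) := by
  rw [Matrix.map_mul, ← Matrix.submatrix_map, Matrix.map_one _ (map_zero _) (map_one _), Matrix.diagonal_map (map_zero _)]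
  simp only [embTwist_ofReal]

/-- … and `D_s⁻¹ · P_σ⁻¹`. -/
theorem map_embTwist_diagonal_inv_mul_perm :
    ((Matrix.diagonal fun j => (((V.sylvesterScale j : ℝ) : ℂ))⁻¹) *
        (1 : Matrix (Fin 3) (Fin 3) ℂ).submatrix V.rationalFramePerm id).map (UnitaryGroup.embTwist (L : Type) ι₁) =
      (Matrix.diagonal fun j => (((V.sylvesterScale j : ℝ) : ℂ))⁻¹) *
        (1 : Matrix (Fin 3) (Fin 3) ℂ).submatrix V.rationalFramePerm id := by
  rw [Matrix.map_mul, ← Matrix.submatrix_map, Matrix.map_one _ (map_zero _) (map_one _), Matrix.diagonal_map (map_zero _)]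
  simp only [map_inv₀, embTwist_ofReal]

/-- **the `w(ι₁)`-matrix of the section of record**: `GL₃(embTwist)(F⁻¹ (T u T⁻¹) F) = (D_s · tw(u) · D_s⁻¹)^{σ⁻¹, σ⁻¹}`. -/
theorem coe_map_embTwist_frameConj (u : U21) :
    ((Matrix.GeneralLinearGroup.map (UnitaryGroup.embTwist (L : Type) ι₁)
        ((Matrix.GeneralLinearGroup.map ι₁ (frameG V))⁻¹ * (V.sylvesterFrame * (u : GL (Fin 3) ℂ) * V.sylvesterFrame⁻¹) *
          Matrix.GeneralLinearGroup.map ι₁ (frameG V)) : GL (Fin 3) ℂ) : Matrix (Fin 3) (Fin 3) ℂ) =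
      ((Matrix.diagonal fun j => ((V.sylvesterScale j : ℝ) : ℂ)) *
          ((u : GL (Fin 3) ℂ) : Matrix (Fin 3) (Fin 3) ℂ).map (UnitaryGroup.embTwist (L : Type) ι₁) *
        Matrix.diagonal fun j => (((V.sylvesterScale j : ℝ) : ℂ))⁻¹).submatrix V.rationalFramePerm.symm V.rationalFramePerm.symm := by
  have hgrp : (Matrix.GeneralLinearGroup.map ι₁ (frameG V))⁻¹ * (V.sylvesterFrame * (u : GL (Fin 3) ℂ) * V.sylvesterFrame⁻¹) *
      Matrix.GeneralLinearGroup.map ι₁ (frameG V) =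
      ((Matrix.GeneralLinearGroup.map ι₁ (frameG V))⁻¹ * V.sylvesterFrame) * (u : GL (Fin 3) ℂ) *
        ((Matrix.GeneralLinearGroup.map ι₁ (frameG V))⁻¹ * V.sylvesterFrame)⁻¹ := by
    group
  rw [hgrp, map_mul, map_mul, ← map_inv, Units.val_mul, Units.val_mul]
  show ((((Matrix.GeneralLinearGroup.map ι₁ (frameG V))⁻¹ * V.sylvesterFrame : GL (Fin 3) ℂ)) : Matrix (Fin 3) (Fin 3) ℂ).map _ *
      (((u : GL (Fin 3) ℂ) : Matrix (Fin 3) (Fin 3) ℂ).map _) *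
      (((((Matrix.GeneralLinearGroup.map ι₁ (frameG V))⁻¹ * V.sylvesterFrame)⁻¹ : GL (Fin 3) ℂ)) : Matrix (Fin 3) (Fin 3) ℂ).map _ = _
  rw [coe_frameInv_mul_sylvesterFrame, coe_frameInv_mul_sylvesterFrame_inv, map_embTwist_perm_mul_diagonal,
    map_embTwist_diagonal_inv_mul_perm, ← Matrix.mul_assoc, Matrix.mul_submatrix_one,
    Matrix.mul_assoc ((1 : Matrix (Fin 3) (Fin 3) ℂ).submatrix _ _), Matrix.mul_assoc ((1 : Matrix (Fin 3) (Fin 3) ℂ).submatrix _ _),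
    Matrix.one_submatrix_mul, Matrix.submatrix_submatrix]
  simp only [Function.comp_id, Function.id_comp, Matrix.mul_assoc]

/-- **`√|x_V(v₁) i| · s (σ⁻¹ i) = 1`**: binder-2's scaling against the Sylvester scaling. -/
theorem cmDV_mul_sylvesterScale (i : Fin 3) :
    ((HypCensus.cmDV (L : Type) (frameD V) (frameD_real V) ι₁ (HypCensus.cmPlace (L : Type) ι₁) i : ℝ) : ℂ) *
      ((V.sylvesterScale (V.rationalFramePerm.symm i) : ℝ) : ℂ) = 1 := by
  rw [← Complex.ofReal_mul, ← Complex.ofReal_one, Complex.ofReal_inj]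
  show Real.sqrt |HypCensus.cmXV (L : Type) (frameD V) (frameD_real V) ι₁ (HypCensus.cmPlace (L : Type) ι₁) i| *
      (Real.sqrt |V.rationalFrame_r (V.rationalFramePerm (V.rationalFramePerm.symm i))|)⁻¹ = 1
  rw [Equiv.apply_symm_apply, cmXV_cmPlace_frameD]
  exact mul_inv_cancel₀ (Real.sqrt_ne_zero'.2 (abs_pos.2 (V.rationalFrame_r_ne_zero i)))

section Main

variable {M : ℕ} (dW : Fin M → (L : Type)) (hdW : ∀ i, IsCMField.complexConj L (dW i) = dW i) (hdW0 : ∀ i, dW i ≠ 0)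

/-- the first un-relabelled component on the twisted ball frame, as a matrix: `reindex (eP ⊕ eQ)⁻¹ (reindex frameIdx (tw u))`. -/
theorem coe_cmRelabel_symm_u21FrameEquiv_fst (u : U21) :
    (((((HypCensus.cmRelabel (L : Type) (frameD V) (frameD_real V) dW hdW ι₁ (blockPosEquiv V) (blockNegEquiv V)).symm
        (u21FrameEquiv (twistU21 L ι₁ u), 1)).1 : UForm (PinPos V) (PinNeg V)) : GL (PinPos V ⊕ PinNeg V) ℂ) :
          Matrix (PinPos V ⊕ PinNeg V) (PinPos V ⊕ PinNeg V) ℂ) =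
      Matrix.reindex (Equiv.sumCongr (blockPosEquiv V) (blockNegEquiv V)).symm (Equiv.sumCongr (blockPosEquiv V) (blockNegEquiv V)).symm
        (Matrix.reindex frameIdx frameIdx (((u : GL (Fin 3) ℂ) : Matrix (Fin 3) (Fin 3) ℂ).map (UnitaryGroup.embTwist (L : Type) ι₁))) :=
  rfl

/-- **FRAME MATCHING AT `w₁`.**  The `V`-component of the inverse pair frame on `(u21FrameEquiv (twistU21 u), 1)`, un-relabelled by
the canonical `eP ⊕ eQ`, has the matrix `GL₃(embTwist L ι₁)(F⁻¹ (T u T⁻¹) F)` of the `w(ι₁)`-component of the section of record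
(`Model/ArchKTypeOfSection.coe_archAt_archSectionFrameOf_cmPlace'`). -/
theorem coe_cmPairFrameEquiv_symm_twist_fst (u : U21) :
    ((((HypCensus.cmPairFrameEquiv (L : Type) (frameD V) (frameD_real V) (frameD_ne V) dW hdW hdW0 ι₁).symm
        ((HypCensus.cmRelabel (L : Type) (frameD V) (frameD_real V) dW hdW ι₁ (blockPosEquiv V) (blockNegEquiv V)).symm
          (u21FrameEquiv (twistU21 L ι₁ u), 1))).1 :
          UnitaryGroup.archLocal (L : Type) 3 (Matrix.diagonal (frameD V)) (cmPlaceOver (L : Type) (HypCensus.cmPlace (L : Type) ι₁))) :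
        GL (Fin 3) ℂ) =
      Matrix.GeneralLinearGroup.map (UnitaryGroup.embTwist (L : Type) ι₁)
        ((Matrix.GeneralLinearGroup.map ι₁ (frameG V))⁻¹ * (V.sylvesterFrame * (u : GL (Fin 3) ℂ) * V.sylvesterFrame⁻¹) *
          Matrix.GeneralLinearGroup.map ι₁ (frameG V)) := by
  set Φ := HypCensus.cmPairFrameEquiv (L : Type) (frameD V) (frameD_real V) (frameD_ne V) dW hdW hdW0 ι₁ with hΦ
  set g' := (HypCensus.cmRelabel (L : Type) (frameD V) (frameD_real V) dW hdW ι₁ (blockPosEquiv V) (blockNegEquiv V)).symm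
      (u21FrameEquiv (twistU21 L ι₁ u), 1) with hg'
  have h1 : GLn.reindexEquiv (R := ℂ) (HypCensus.cmEpsV (L : Type) (frameD V) (frameD_real V) ι₁ (HypCensus.cmPlace (L : Type) ι₁))
      (scaleGL (HypCensus.cmDV (L : Type) (frameD V) (frameD_real V) ι₁ (HypCensus.cmPlace (L : Type) ι₁))
          (HypCensus.cmDV_ne_zero (L : Type) (frameD V) (frameD_real V) (frameD_ne V) ι₁ (HypCensus.cmPlace (L : Type) ι₁)) *
        (((Φ.symm g').1 : UnitaryGroup.archLocal (L : Type) 3 (Matrix.diagonal (frameD V)) (cmPlaceOver (L : Type) (HypCensus.cmPlace (L : Type) ι₁))) : GL (Fin 3) ℂ) *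
        (scaleGL (HypCensus.cmDV (L : Type) (frameD V) (frameD_real V) ι₁ (HypCensus.cmPlace (L : Type) ι₁))
          (HypCensus.cmDV_ne_zero (L : Type) (frameD V) (frameD_real V) (frameD_ne V) ι₁ (HypCensus.cmPlace (L : Type) ι₁)))⁻¹) =
      ((g'.1 : UForm (PinPos V) (PinNeg V)) : GL (PinPos V ⊕ PinNeg V) ℂ) :=
    congrArg (fun x : Ginf (PinPos V) (PinNeg V) _ _ => ((x.1 : UForm (PinPos V) (PinNeg V)) : GL (PinPos V ⊕ PinNeg V) ℂ))
      (Φ.apply_symm_apply g')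
  have h2 : GLn.reindexEquiv (R := ℂ) (HypCensus.cmEpsV (L : Type) (frameD V) (frameD_real V) ι₁ (HypCensus.cmPlace (L : Type) ι₁))
      (scaleGL (HypCensus.cmDV (L : Type) (frameD V) (frameD_real V) ι₁ (HypCensus.cmPlace (L : Type) ι₁))
          (HypCensus.cmDV_ne_zero (L : Type) (frameD V) (frameD_real V) (frameD_ne V) ι₁ (HypCensus.cmPlace (L : Type) ι₁)) *
        Matrix.GeneralLinearGroup.map (UnitaryGroup.embTwist (L : Type) ι₁)
          ((Matrix.GeneralLinearGroup.map ι₁ (frameG V))⁻¹ * (V.sylvesterFrame * (u : GL (Fin 3) ℂ) * V.sylvesterFrame⁻¹) *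
            Matrix.GeneralLinearGroup.map ι₁ (frameG V)) *
        (scaleGL (HypCensus.cmDV (L : Type) (frameD V) (frameD_real V) ι₁ (HypCensus.cmPlace (L : Type) ι₁))
          (HypCensus.cmDV_ne_zero (L : Type) (frameD V) (frameD_real V) (frameD_ne V) ι₁ (HypCensus.cmPlace (L : Type) ι₁)))⁻¹) =
      ((g'.1 : UForm (PinPos V) (PinNeg V)) : GL (PinPos V ⊕ PinNeg V) ℂ) := by
    apply Units.ext
    rw [GLn.coe_reindexEquiv_apply, Units.val_mul, Units.val_mul, coe_map_embTwist_frameConj, coe_scaleGL, coe_scaleGL_inv, hg',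
      coe_cmRelabel_symm_u21FrameEquiv_fst]
    ext p q
    obtain ⟨i, rfl⟩ := (HypCensus.cmEpsV (L : Type) (frameD V) (frameD_real V) ι₁ (HypCensus.cmPlace (L : Type) ι₁)).surjective p
    obtain ⟨i', rfl⟩ := (HypCensus.cmEpsV (L : Type) (frameD V) (frameD_real V) ι₁ (HypCensus.cmPlace (L : Type) ι₁)).surjective q
    simp only [Matrix.reindex_apply, Matrix.submatrix_apply, Equiv.symm_apply_apply, Equiv.symm_symm,
      frameIdx_symm_sumCongr_cmEpsV, Matrix.diagonal_mul, Matrix.mul_diagonal, Matrix.map_apply]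
    have hi := cmDV_mul_sylvesterScale V i
    have hi' := cmDV_mul_sylvesterScale V i'
    calc _ = (((HypCensus.cmDV (L : Type) (frameD V) (frameD_real V) ι₁ (HypCensus.cmPlace (L : Type) ι₁) i : ℝ) : ℂ) *
          ((V.sylvesterScale (V.rationalFramePerm.symm i) : ℝ) : ℂ)) *
          UnitaryGroup.embTwist (L : Type) ι₁ (((u : GL (Fin 3) ℂ) : Matrix (Fin 3) (Fin 3) ℂ) (V.rationalFramePerm.symm i)
            (V.rationalFramePerm.symm i')) *
          (((HypCensus.cmDV (L : Type) (frameD V) (frameD_real V) ι₁ (HypCensus.cmPlace (L : Type) ι₁) i' : ℝ) : ℂ) *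
            ((V.sylvesterScale (V.rationalFramePerm.symm i') : ℝ) : ℂ))⁻¹ := by ring
      _ = _ := by rw [hi, hi', inv_one, one_mul, mul_one]
  have h4 := (GLn.reindexEquiv (R := ℂ)
    (HypCensus.cmEpsV (L : Type) (frameD V) (frameD_real V) ι₁ (HypCensus.cmPlace (L : Type) ι₁))).injective (h1.trans h2.symm)
  exact mul_left_cancel (mul_right_cancel h4)

end Main

/-! ## § 5 The frame matching in `U(diag d)(L ⊗ ℝ)` -/

/-- binder-2's complex place over the pin IS `w(ι₁)` (`cmPlaceOver_eq_mk`). -/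
theorem cmPlaceOver_cmPlace_eq :
    cmPlaceOver (L : Type) (HypCensus.cmPlace (L : Type) ι₁) = UnitaryGroup.cmPlace (L : Type) ι₁ :=
  Subtype.ext (cmPlaceOver_eq_mk (L : Type) (HypCensus.cmPlace (L : Type) ι₁) ι₁ rfl)


-- port_pkg: scope closed for this part
end HodgeCM.Model
end
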